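import Summits.QuantumFields.YangMills.Theorems.UnitScaleTiltProp7PinnedRegaugeChartBCH
import Summits.QuantumFields.YangMills.Theorems.UnitScaleTiltProp7BCHRemainderLipschitz
import Literature.MathematicalPhysics.QuantumFieldTheory.Balaban1983to89.MatrixLogLipschitz
import HarnessLib

/-!
# Route `UnitScaleTilt`, crux K1 «MinimiserStabilityRegPr» (stmt-QuantumFields-19200), route-R E′ path (α′), row (P-bch-div) — (C¹-Φ):
# THE CHART REMAINDER `R₂ = Φ(u₋, u₊, W, E)` OF A PINNED RE-GAUGING IS BILINEARLY LIPSCHITZ IN ITS FOUR ARGUMENTS —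
# `‖Φ(a) − Φ(a′)‖ ≤ 160(σ + τ)·(‖u₋ − u₋′‖ + ‖u₊ − u₊′‖ + ‖E − E′‖ + ‖W − W′‖)` for `‖u±⁽′⁾ − 1‖ ≤ σ ≤ 1∕256`, `‖E⁽′⁾ − 1‖ ≤ τ ≤ 1∕256`

Cell `ym3-torus`, width seat `ym3-torus-px15` (gen 0); pen (P-bch-div) ∕ (C¹-Φ) named by ★p1 g14 (2026-08-28 17:46Z «fork (L) … C¹-BCH → C¹-Φ → assembly LAST»).  THEOREMS ONLY (0 `def`,
0 `sorry`); `--supports stmt-QuantumFields-19200`, count-neutral.  YM₃ on T³ is a ladder rung (R3), not the Clay problem; nothing here claims a stub, the crux, d = 4 or the mass gap.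

WHY.  ✓ `Prop7PinnedRegaugeChartBCH.norm_mlog_regauge_sub_le` writes the chart of a re-gauged configuration as `log(u₋EWu₊*W*) = log E + (μ₋ − Wμ₊W*) + Φ` with `Φ` small (products of two small
quantities).  The divergence row of (P-bch) takes bondwise DIFFERENCES of `Φ` (memo `LOCATE-PBCH-DIV-px15.md`): they must be (small) × (difference of the arguments), else the row loses `ℓ²`.
THIS FILE proves exactly that, at the matrix level, from the decomposition used in ✓p653615's proof — `Φ = r(A, log G) + ((u₋−1)(log E)u₋* + (log E)(u₋*−1)) + r(μ₋, −μ₋ + δ)`, `A = u₋(log E)u₋*`,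
`G = u₋Wu₊*W*`, `δ = μ₋ − Wμ₊W*`, `r(X,Y) = log(eˣe^Y) − X − Y` — with the two BCH remainders handled by ✓ `Prop7BCHRemainderLipschitz.norm_bch_sub_bch_le_of_norm_le` (C¹-BCH: Lipschitz
in each exponent with constant ∝ the OTHER exponent), the explicit piece by Leibniz, and `log` by ✓ `MatrixLogLipschitz.norm_mlog_sub_mlog_le`.  `W, W′ ∈ SU(N)` are NOT assumed close to `1` (only to each
other, through `‖W − W′‖`, whose coefficient is `O(τ + σ²)`).

WHAT IS PROVED (ns `…Theorems.Prop7PinnedRegaugeChartLipschitz`; `SU(N)`, any nonempty `Fintype n`).  §1 telescoping letters (`norm_conj_sub_conj_le`, `norm_twist_sub_twist_le`, `norm_pureGauge_sub_pureGauge_le`,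
`norm_bilin_sub_bilin_le`); §2 ★★★ `norm_chartRemainder_sub_le` (the title bound, with `Φ` displayed as `mlog(u₋EWu₊*W*) − (mlog E + (mlog u₋ − W·mlog u₊·W*))`).
HONEST SCOPE.  Matrix analysis only; the covariant assembly of the (P-bch-div) row (differences along bonds in the door's `divB (torusT …)` letters, Weitzenböck ✓ `sum_covD_sq_le_curl_sq_add_divB_sq`,
✓p648418, the typed corrector `ψ`) is NOT here (★p1: «assembly LAST, waits on ψ's typed letters»).  Constants ours (crude: 160).

References: T. Bałaban, CMP 98 (1985) 17–51 [Balaban1985Averaging] ((8), (11) p.19, (21) p.21, (31) p.22); CMP 102 (1985) 277–309 [Balaban1985Variational] ((15) p.280, (141)–(143) p.299).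
-/

set_option autoImplicit false

noncomputable section

open scoped BigOperators Matrix.Norms.L2Operator
open NormedSpace

namespace Summit.QuantumFields.YangMills.Theorems.Prop7PinnedRegaugeChartLipschitz

open Literature.MathematicalPhysics.QuantumFieldTheory.Balaban1983to89
open MatrixLog (mlog exp_mlog norm_mlog_le_two_mul)
open MatrixLogLipschitz (norm_mlog_sub_mlog_le)
open Summit.QuantumFields.YangMills.Theorems.Prop7HolRatioPerStep (coe_star_mul_self coe_mul_star_self norm_coe_eq_one norm_star_coe_eq_one)
open Summit.QuantumFields.YangMills.Theorems.Prop7CovIterLambdaBound (norm_conj_su_le)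
open Summit.QuantumFields.YangMills.Theorems.Prop7GaugeTwistLogRatio (exp_conj_coe star_coe_eq_exp_neg_mlog)
open Summit.QuantumFields.YangMills.Theorems.Prop7PinnedRegaugeChartBCH (regauge_eq_exp_mul_exp norm_twist_sub_one_le norm_sub_conj_le)
open Summit.QuantumFields.YangMills.Theorems.Prop7BCHRemainderLipschitz (norm_bch_sub_bch_le_of_norm_le)

variable {n : Type*} [Fintype n] [DecidableEq n] [Nonempty n]

/-! ## §1 Telescoping letters -/

section Telescoping

omit [Nonempty n] in
/-- `‖u* − v*‖ = ‖u − v‖` (star is an isometry). [folklore] -/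
theorem norm_star_sub_star (u v : Matrix.specialUnitaryGroup n ℂ) :
    ‖star (u : Matrix n n ℂ) - star (v : Matrix n n ℂ)‖ = ‖(u : Matrix n n ℂ) - (v : Matrix n n ℂ)‖ := by
  rw [← star_sub, norm_star]

/-- `‖uXu* − vX′v*‖ ≤ 2‖X‖·‖u − v‖ + 3‖X − X′‖` for `u, v ∈ SU(N)`. [folklore] -/
theorem norm_conj_sub_conj_le (u v : Matrix.specialUnitaryGroup n ℂ) (X X' : Matrix n n ℂ) :
    ‖(u : Matrix n n ℂ) * X * star (u : Matrix n n ℂ) - (v : Matrix n n ℂ) * X' * star (v : Matrix n n ℂ)‖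
      ≤ 2 * ‖X‖ * ‖(u : Matrix n n ℂ) - (v : Matrix n n ℂ)‖ + 3 * ‖X - X'‖ := by
  have e : (u : Matrix n n ℂ) * X * star (u : Matrix n n ℂ) - (v : Matrix n n ℂ) * X' * star (v : Matrix n n ℂ)
      = ((u : Matrix n n ℂ) - (v : Matrix n n ℂ)) * X * star (u : Matrix n n ℂ) + (v : Matrix n n ℂ) * (X - X') * star (u : Matrix n n ℂ)
        + (v : Matrix n n ℂ) * X' * (star (u : Matrix n n ℂ) - star (v : Matrix n n ℂ)) := by noncomm_ring
  rw [e]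
  have h1 : ‖((u : Matrix n n ℂ) - (v : Matrix n n ℂ)) * X * star (u : Matrix n n ℂ)‖ ≤ ‖(u : Matrix n n ℂ) - (v : Matrix n n ℂ)‖ * ‖X‖ := by
    calc _ ≤ ‖((u : Matrix n n ℂ) - (v : Matrix n n ℂ)) * X‖ * ‖star (u : Matrix n n ℂ)‖ := norm_mul_le _ _
      _ ≤ ‖(u : Matrix n n ℂ) - (v : Matrix n n ℂ)‖ * ‖X‖ * ‖star (u : Matrix n n ℂ)‖ := by gcongr; exact norm_mul_le _ _
      _ = _ := by rw [norm_star_coe_eq_one, mul_one]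
  have h2 : ‖(v : Matrix n n ℂ) * (X - X') * star (u : Matrix n n ℂ)‖ ≤ ‖X - X'‖ := by
    calc _ ≤ ‖(v : Matrix n n ℂ) * (X - X')‖ * ‖star (u : Matrix n n ℂ)‖ := norm_mul_le _ _
      _ ≤ ‖(v : Matrix n n ℂ)‖ * ‖X - X'‖ * ‖star (u : Matrix n n ℂ)‖ := by gcongr; exact norm_mul_le _ _
      _ = _ := by rw [norm_star_coe_eq_one, norm_coe_eq_one, one_mul, mul_one]
  have h3 : ‖(v : Matrix n n ℂ) * X' * (star (u : Matrix n n ℂ) - star (v : Matrix n n ℂ))‖ ≤ ‖X'‖ * ‖(u : Matrix n n ℂ) - (v : Matrix n n ℂ)‖ := by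
    calc _ ≤ ‖(v : Matrix n n ℂ) * X'‖ * ‖star (u : Matrix n n ℂ) - star (v : Matrix n n ℂ)‖ := norm_mul_le _ _
      _ ≤ ‖(v : Matrix n n ℂ)‖ * ‖X'‖ * ‖star (u : Matrix n n ℂ) - star (v : Matrix n n ℂ)‖ := by gcongr; exact norm_mul_le _ _
      _ = _ := by rw [norm_coe_eq_one, one_mul, norm_star_sub_star]
  have h4 : ‖X'‖ ≤ ‖X‖ + ‖X - X'‖ := by
    calc ‖X'‖ = ‖X - (X - X')‖ := by rw [sub_sub_cancel]
      _ ≤ ‖X‖ + ‖X - X'‖ := norm_sub_le _ _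
  have hd : 0 ≤ ‖(u : Matrix n n ℂ) - (v : Matrix n n ℂ)‖ := norm_nonneg _
  have hduv : ‖(u : Matrix n n ℂ) - (v : Matrix n n ℂ)‖ ≤ 2 := by
    calc _ ≤ ‖(u : Matrix n n ℂ)‖ + ‖(v : Matrix n n ℂ)‖ := norm_sub_le _ _
      _ = 2 := by rw [norm_coe_eq_one, norm_coe_eq_one]; norm_num
  calc _ ≤ ‖(u : Matrix n n ℂ) - (v : Matrix n n ℂ)‖ * ‖X‖ + ‖X - X'‖ + ‖X'‖ * ‖(u : Matrix n n ℂ) - (v : Matrix n n ℂ)‖ := norm_add₃_le.trans (add_le_add (add_le_add h1 h2) h3)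
    _ ≤ ‖(u : Matrix n n ℂ) - (v : Matrix n n ℂ)‖ * ‖X‖ + ‖X - X'‖ + (‖X‖ + ‖X - X'‖) * ‖(u : Matrix n n ℂ) - (v : Matrix n n ℂ)‖ := by gcongr
    _ ≤ _ := by nlinarith [norm_nonneg (X - X'), norm_nonneg X]

omit [Nonempty n] in
/-- `‖A·B‖ ≤ ‖A‖` when `‖B‖ ≤ 1`. [folklore] -/
theorem norm_mul_le_left_of_le_one {A B : Matrix n n ℂ} (h : ‖B‖ ≤ 1) : ‖A * B‖ ≤ ‖A‖ :=
  (norm_mul_le _ _).trans (by simpa using mul_le_mul_of_nonneg_left h (norm_nonneg A))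

omit [Nonempty n] in
/-- `‖A·B‖ ≤ ‖B‖` when `‖A‖ ≤ 1`. [folklore] -/
theorem norm_mul_le_right_of_le_one {A B : Matrix n n ℂ} (h : ‖A‖ ≤ 1) : ‖A * B‖ ≤ ‖B‖ :=
  (norm_mul_le _ _).trans (by simpa using mul_le_mul_of_nonneg_right h (norm_nonneg B))

/-- `‖u₋Wu₊*W* − u₋′W′u₊′*W′*‖ ≤ ‖u₋ − u₋′‖ + ‖u₊ − u₊′‖ + 2‖W − W′‖` (four unitary factors). [folklore] -/
theorem norm_twist_sub_twist_le (um up W um' up' W' : Matrix.specialUnitaryGroup n ℂ) :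
    ‖(um : Matrix n n ℂ) * (W : Matrix n n ℂ) * star (up : Matrix n n ℂ) * star (W : Matrix n n ℂ)
        - (um' : Matrix n n ℂ) * (W' : Matrix n n ℂ) * star (up' : Matrix n n ℂ) * star (W' : Matrix n n ℂ)‖
      ≤ ‖(um : Matrix n n ℂ) - (um' : Matrix n n ℂ)‖ + ‖(up : Matrix n n ℂ) - (up' : Matrix n n ℂ)‖ + 2 * ‖(W : Matrix n n ℂ) - (W' : Matrix n n ℂ)‖ := by
  have e : (um : Matrix n n ℂ) * (W : Matrix n n ℂ) * star (up : Matrix n n ℂ) * star (W : Matrix n n ℂ)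
        - (um' : Matrix n n ℂ) * (W' : Matrix n n ℂ) * star (up' : Matrix n n ℂ) * star (W' : Matrix n n ℂ)
      = ((um : Matrix n n ℂ) - (um' : Matrix n n ℂ)) * ((W : Matrix n n ℂ) * (star (up : Matrix n n ℂ) * star (W : Matrix n n ℂ)))
        + (um' : Matrix n n ℂ) * (((W : Matrix n n ℂ) - (W' : Matrix n n ℂ)) * (star (up : Matrix n n ℂ) * star (W : Matrix n n ℂ)))
        + (um' : Matrix n n ℂ) * ((W' : Matrix n n ℂ) * ((star (up : Matrix n n ℂ) - star (up' : Matrix n n ℂ)) * star (W : Matrix n n ℂ)))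
        + (um' : Matrix n n ℂ) * ((W' : Matrix n n ℂ) * (star (up' : Matrix n n ℂ) * (star (W : Matrix n n ℂ) - star (W' : Matrix n n ℂ)))) := by
    noncomm_ring
  rw [e]
  have n1 : ∀ (g : Matrix.specialUnitaryGroup n ℂ), ‖(g : Matrix n n ℂ)‖ ≤ 1 := fun g => (norm_coe_eq_one g).le
  have n2 : ∀ (g : Matrix.specialUnitaryGroup n ℂ), ‖star (g : Matrix n n ℂ)‖ ≤ 1 := fun g => (norm_star_coe_eq_one g).le
  have h1 : ‖((um : Matrix n n ℂ) - (um' : Matrix n n ℂ)) * ((W : Matrix n n ℂ) * (star (up : Matrix n n ℂ) * star (W : Matrix n n ℂ)))‖ ≤ ‖(um : Matrix n n ℂ) - (um' : Matrix n n ℂ)‖ :=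
    norm_mul_le_left_of_le_one ((norm_mul_le_right_of_le_one (n1 W)).trans ((norm_mul_le_right_of_le_one (n2 up)).trans (n2 W)))
  have h2 : ‖(um' : Matrix n n ℂ) * (((W : Matrix n n ℂ) - (W' : Matrix n n ℂ)) * (star (up : Matrix n n ℂ) * star (W : Matrix n n ℂ)))‖ ≤ ‖(W : Matrix n n ℂ) - (W' : Matrix n n ℂ)‖ :=
    (norm_mul_le_right_of_le_one (n1 um')).trans (norm_mul_le_left_of_le_one ((norm_mul_le_right_of_le_one (n2 up)).trans (n2 W)))
  have h3 : ‖(um' : Matrix n n ℂ) * ((W' : Matrix n n ℂ) * ((star (up : Matrix n n ℂ) - star (up' : Matrix n n ℂ)) * star (W : Matrix n n ℂ)))‖ ≤ ‖(up : Matrix n n ℂ) - (up' : Matrix n n ℂ)‖ := by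
    refine (norm_mul_le_right_of_le_one (n1 um')).trans ((norm_mul_le_right_of_le_one (n1 W')).trans ?_)
    rw [← norm_star_sub_star up up']
    exact norm_mul_le_left_of_le_one (n2 W)
  have h4 : ‖(um' : Matrix n n ℂ) * ((W' : Matrix n n ℂ) * (star (up' : Matrix n n ℂ) * (star (W : Matrix n n ℂ) - star (W' : Matrix n n ℂ))))‖ ≤ ‖(W : Matrix n n ℂ) - (W' : Matrix n n ℂ)‖ := by
    refine (norm_mul_le_right_of_le_one (n1 um')).trans ((norm_mul_le_right_of_le_one (n1 W')).trans ((norm_mul_le_right_of_le_one (n2 up')).trans ?_))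
    rw [norm_star_sub_star W W']
  have hsum := (norm_add_le _ _).trans (add_le_add ((norm_add_le _ _).trans (add_le_add ((norm_add_le _ _).trans (add_le_add h1 h2)) h3)) h4)
  refine hsum.trans (le_of_eq ?_)
  ring

/-- The explicit bilinear piece: `‖[(u−1)Xu* + X(u*−1)] − [(v−1)X′v* + X′(v*−1)]‖ ≤ (2‖X‖ + ‖X′‖)(1 + ‖v − 1‖)… ≤ 3(‖X‖ + ‖X′‖)·‖u − v‖ + 2‖v − 1‖·‖X − X′‖` (Leibniz). [folklore] -/
theorem norm_bilin_sub_bilin_le (u v : Matrix.specialUnitaryGroup n ℂ) (X X' : Matrix n n ℂ) :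
    ‖(((u : Matrix n n ℂ) - 1) * X * star (u : Matrix n n ℂ) + X * (star (u : Matrix n n ℂ) - 1))
        - (((v : Matrix n n ℂ) - 1) * X' * star (v : Matrix n n ℂ) + X' * (star (v : Matrix n n ℂ) - 1))‖
      ≤ 3 * (‖X‖ + ‖X'‖) * ‖(u : Matrix n n ℂ) - (v : Matrix n n ℂ)‖ + 2 * ‖(v : Matrix n n ℂ) - 1‖ * ‖X - X'‖ := by
  have e : (((u : Matrix n n ℂ) - 1) * X * star (u : Matrix n n ℂ) + X * (star (u : Matrix n n ℂ) - 1))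
        - (((v : Matrix n n ℂ) - 1) * X' * star (v : Matrix n n ℂ) + X' * (star (v : Matrix n n ℂ) - 1))
      = ((u : Matrix n n ℂ) - (v : Matrix n n ℂ)) * X * star (u : Matrix n n ℂ)
        + ((v : Matrix n n ℂ) - 1) * (X - X') * star (u : Matrix n n ℂ)
        + ((v : Matrix n n ℂ) - 1) * X' * (star (u : Matrix n n ℂ) - star (v : Matrix n n ℂ))
        + (X - X') * (star (v : Matrix n n ℂ) - 1)
        + X * (star (u : Matrix n n ℂ) - star (v : Matrix n n ℂ)) := by noncomm_ring
  rw [e]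
  have hsv : ‖star (v : Matrix n n ℂ) - 1‖ = ‖(v : Matrix n n ℂ) - 1‖ := by
    rw [← norm_star (star (v : Matrix n n ℂ) - 1), star_sub, star_star, star_one]
  have h1 : ‖((u : Matrix n n ℂ) - (v : Matrix n n ℂ)) * X * star (u : Matrix n n ℂ)‖ ≤ ‖(u : Matrix n n ℂ) - (v : Matrix n n ℂ)‖ * ‖X‖ := by
    calc _ ≤ ‖((u : Matrix n n ℂ) - (v : Matrix n n ℂ)) * X‖ * ‖star (u : Matrix n n ℂ)‖ := norm_mul_le _ _
      _ ≤ ‖(u : Matrix n n ℂ) - (v : Matrix n n ℂ)‖ * ‖X‖ * ‖star (u : Matrix n n ℂ)‖ := by gcongr; exact norm_mul_le _ _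
      _ = _ := by rw [norm_star_coe_eq_one, mul_one]
  have h2 : ‖((v : Matrix n n ℂ) - 1) * (X - X') * star (u : Matrix n n ℂ)‖ ≤ ‖(v : Matrix n n ℂ) - 1‖ * ‖X - X'‖ := by
    calc _ ≤ ‖((v : Matrix n n ℂ) - 1) * (X - X')‖ * ‖star (u : Matrix n n ℂ)‖ := norm_mul_le _ _
      _ ≤ ‖(v : Matrix n n ℂ) - 1‖ * ‖X - X'‖ * ‖star (u : Matrix n n ℂ)‖ := by gcongr; exact norm_mul_le _ _
      _ = _ := by rw [norm_star_coe_eq_one, mul_one]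
  have h3 : ‖((v : Matrix n n ℂ) - 1) * X' * (star (u : Matrix n n ℂ) - star (v : Matrix n n ℂ))‖ ≤ ‖(v : Matrix n n ℂ) - 1‖ * ‖X'‖ * ‖(u : Matrix n n ℂ) - (v : Matrix n n ℂ)‖ := by
    calc _ ≤ ‖((v : Matrix n n ℂ) - 1) * X'‖ * ‖star (u : Matrix n n ℂ) - star (v : Matrix n n ℂ)‖ := norm_mul_le _ _
      _ ≤ ‖(v : Matrix n n ℂ) - 1‖ * ‖X'‖ * ‖star (u : Matrix n n ℂ) - star (v : Matrix n n ℂ)‖ := by gcongr; exact norm_mul_le _ _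
      _ = _ := by rw [norm_star_sub_star]
  have h4 : ‖(X - X') * (star (v : Matrix n n ℂ) - 1)‖ ≤ ‖X - X'‖ * ‖(v : Matrix n n ℂ) - 1‖ := by
    calc _ ≤ ‖X - X'‖ * ‖star (v : Matrix n n ℂ) - 1‖ := norm_mul_le _ _
      _ = _ := by rw [hsv]
  have h5 : ‖X * (star (u : Matrix n n ℂ) - star (v : Matrix n n ℂ))‖ ≤ ‖X‖ * ‖(u : Matrix n n ℂ) - (v : Matrix n n ℂ)‖ := by
    calc _ ≤ ‖X‖ * ‖star (u : Matrix n n ℂ) - star (v : Matrix n n ℂ)‖ := norm_mul_le _ _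
      _ = _ := by rw [norm_star_sub_star]
  have hv2 : ‖(v : Matrix n n ℂ) - 1‖ ≤ 2 := by
    calc _ ≤ ‖(v : Matrix n n ℂ)‖ + ‖(1 : Matrix n n ℂ)‖ := norm_sub_le _ _
      _ = 2 := by rw [norm_coe_eq_one, norm_one]; norm_num
  have hX0 : 0 ≤ ‖X‖ := norm_nonneg _
  have hX'0 : 0 ≤ ‖X'‖ := norm_nonneg _
  have hd0 : 0 ≤ ‖(u : Matrix n n ℂ) - (v : Matrix n n ℂ)‖ := norm_nonneg _
  have hv0 : 0 ≤ ‖(v : Matrix n n ℂ) - 1‖ := norm_nonneg _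
  have hdX0 : 0 ≤ ‖X - X'‖ := norm_nonneg _
  calc _ ≤ ‖(u : Matrix n n ℂ) - (v : Matrix n n ℂ)‖ * ‖X‖ + ‖(v : Matrix n n ℂ) - 1‖ * ‖X - X'‖ + ‖(v : Matrix n n ℂ) - 1‖ * ‖X'‖ * ‖(u : Matrix n n ℂ) - (v : Matrix n n ℂ)‖
        + ‖X - X'‖ * ‖(v : Matrix n n ℂ) - 1‖ + ‖X‖ * ‖(u : Matrix n n ℂ) - (v : Matrix n n ℂ)‖ := by
        refine (norm_add_le _ _).trans (add_le_add ((norm_add_le _ _).trans (add_le_add ((norm_add_le _ _).trans (add_le_add ((norm_add_le _ _).trans (add_le_add h1 h2)) h3)) h4)) h5)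
    _ ≤ _ := by nlinarith [mul_nonneg hv0 hX'0, mul_nonneg (mul_nonneg hv0 hX'0) hd0, mul_nonneg hX0 hd0, mul_nonneg hX'0 hd0]

end Telescoping

/-! ## §2 The chart remainder is bilinearly Lipschitz -/

section Main

/-- ★★★ **(C¹-Φ) THE CHART REMAINDER OF A PINNED RE-GAUGING IS BILINEARLY LIPSCHITZ.**  For `u₋, u₊, u₋′, u₊′, W, W′ ∈ SU(N)` with `‖u±⁽′⁾ − 1‖ ≤ σ ≤ 1∕256` and ratios `E, E′` with
`‖E⁽′⁾ − 1‖ ≤ τ ≤ 1∕256`, the remainder `Φ(u₋,u₊,W,E) := log(u₋·E·W·u₊*·W*) − (log E + (log u₋ − W·log u₊·W*))` of ✓ `Prop7PinnedRegaugeChartBCH.norm_mlog_regauge_sub_le` satisfies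
`‖Φ(u₋,u₊,W,E) − Φ(u₋′,u₊′,W′,E′)‖ ≤ 160(σ + τ)·(‖u₋ − u₋′‖ + ‖u₊ − u₊′‖ + ‖E − E′‖ + ‖W − W′‖)` — every difference enters with a SMALL coefficient, including `‖W − W′‖` (the backgrounds
are not assumed close to `1`).  Proof: `Φ = r(u₋(log E)u₋*, log G) + ((u₋−1)(log E)u₋* + (log E)(u₋*−1)) + r(log u₋, −W(log u₊)W*)`, `G = u₋Wu₊*W*`, `r(X,Y) = log(eˣe^Y) − X − Y`; C¹-BCH
(✓ `Prop7BCHRemainderLipschitz.norm_bch_sub_bch_le_of_norm_le`) on the two remainders, Leibniz (`norm_bilin_sub_bilin_le`) on the middle, `log` Lipschitz (✓ `MatrixLogLipschitz.norm_mlog_sub_mlog_le`).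
[cite: Balaban1985Averaging, (31) p.22, (21) p.21, (8) p.19; Balaban1985Variational, (15) p.280, (141)-(143) p.299] -/
theorem norm_chartRemainder_sub_le (um up W um' up' W' : Matrix.specialUnitaryGroup n ℂ) (E E' : Matrix n n ℂ) {σ τ : ℝ}
    (hσ : σ ≤ 1 / 256) (hτ : τ ≤ 1 / 256)
    (hm : ‖(um : Matrix n n ℂ) - 1‖ ≤ σ) (hp : ‖(up : Matrix n n ℂ) - 1‖ ≤ σ) (hm' : ‖(um' : Matrix n n ℂ) - 1‖ ≤ σ) (hp' : ‖(up' : Matrix n n ℂ) - 1‖ ≤ σ)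
    (hE : ‖E - 1‖ ≤ τ) (hE' : ‖E' - 1‖ ≤ τ) :
    ‖(mlog ((um : Matrix n n ℂ) * E * (W : Matrix n n ℂ) * star (up : Matrix n n ℂ) * star (W : Matrix n n ℂ))
          - (mlog E + (mlog (um : Matrix n n ℂ) - (W : Matrix n n ℂ) * mlog (up : Matrix n n ℂ) * star (W : Matrix n n ℂ))))
      - (mlog ((um' : Matrix n n ℂ) * E' * (W' : Matrix n n ℂ) * star (up' : Matrix n n ℂ) * star (W' : Matrix n n ℂ))
          - (mlog E' + (mlog (um' : Matrix n n ℂ) - (W' : Matrix n n ℂ) * mlog (up' : Matrix n n ℂ) * star (W' : Matrix n n ℂ))))‖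
      ≤ 160 * (σ + τ) * (‖(um : Matrix n n ℂ) - (um' : Matrix n n ℂ)‖ + ‖(up : Matrix n n ℂ) - (up' : Matrix n n ℂ)‖ + ‖E - E'‖
          + ‖(W : Matrix n n ℂ) - (W' : Matrix n n ℂ)‖) := by
  have hσ0 : 0 ≤ σ := (norm_nonneg _).trans hm
  have hτ0 : 0 ≤ τ := (norm_nonneg _).trans hE
  -- sizes
  have h64 : ∀ {g : Matrix.specialUnitaryGroup n ℂ}, ‖(g : Matrix n n ℂ) - 1‖ ≤ σ → ‖(g : Matrix n n ℂ) - 1‖ ≤ 1 / 64 := fun h => h.trans (by linarith)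
  have hlogu : ∀ {g : Matrix.specialUnitaryGroup n ℂ}, ‖(g : Matrix n n ℂ) - 1‖ ≤ σ → ‖mlog (g : Matrix n n ℂ)‖ ≤ 2 * σ :=
    fun h => (norm_mlog_le_two_mul (h.trans (by linarith))).trans (by linarith)
  have hlogE : ‖mlog E‖ ≤ 2 * τ := (norm_mlog_le_two_mul (hE.trans (by linarith))).trans (by linarith)
  have hlogE' : ‖mlog E'‖ ≤ 2 * τ := (norm_mlog_le_two_mul (hE'.trans (by linarith))).trans (by linarith)
  have hE1 : ‖E - 1‖ < 1 := by linarith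
  have hE1' : ‖E' - 1‖ < 1 := by linarith
  -- Lipschitz of `log` (radius 1∕2)
  have hlip : ∀ {A B : Matrix n n ℂ}, ‖A - 1‖ ≤ 1 / 2 → ‖B - 1‖ ≤ 1 / 2 → ‖mlog A - mlog B‖ ≤ 2 * ‖A - B‖ := by
    intro A B hA hB
    have h := norm_mlog_sub_mlog_le (r := 1 / 2) (by norm_num) hA hB
    have e : ‖A - B‖ / (1 - 1 / 2) = 2 * ‖A - B‖ := by ring
    rwa [e] at h
  -- the two `G`'s and their logs
  have hG1 : ‖(um : Matrix n n ℂ) * (W : Matrix n n ℂ) * star (up : Matrix n n ℂ) * star (W : Matrix n n ℂ) - 1‖ ≤ 2 * σ :=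
    ((norm_twist_sub_one_le um up W).trans (norm_sub_conj_le um up W)).trans (by linarith)
  have hG1' : ‖(um' : Matrix n n ℂ) * (W' : Matrix n n ℂ) * star (up' : Matrix n n ℂ) * star (W' : Matrix n n ℂ) - 1‖ ≤ 2 * σ :=
    ((norm_twist_sub_one_le um' up' W').trans (norm_sub_conj_le um' up' W')).trans (by linarith)
  have hlogG : ‖mlog ((um : Matrix n n ℂ) * (W : Matrix n n ℂ) * star (up : Matrix n n ℂ) * star (W : Matrix n n ℂ))‖ ≤ 4 * σ :=
    (norm_mlog_le_two_mul (hG1.trans (by linarith))).trans (by linarith)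
  have hlogG' : ‖mlog ((um' : Matrix n n ℂ) * (W' : Matrix n n ℂ) * star (up' : Matrix n n ℂ) * star (W' : Matrix n n ℂ))‖ ≤ 4 * σ :=
    (norm_mlog_le_two_mul (hG1'.trans (by linarith))).trans (by linarith)
  -- the decomposition of each remainder (as in ✓p653615)
  have hdec : ∀ (a c V : Matrix.specialUnitaryGroup n ℂ) (F : Matrix n n ℂ), ‖(a : Matrix n n ℂ) - 1‖ ≤ 1 / 64 → ‖(c : Matrix n n ℂ) - 1‖ ≤ 1 / 64 → ‖F - 1‖ < 1 →
      mlog ((a : Matrix n n ℂ) * F * (V : Matrix n n ℂ) * star (c : Matrix n n ℂ) * star (V : Matrix n n ℂ))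
          - (mlog F + (mlog (a : Matrix n n ℂ) - (V : Matrix n n ℂ) * mlog (c : Matrix n n ℂ) * star (V : Matrix n n ℂ)))
        = (mlog (exp ((a : Matrix n n ℂ) * mlog F * star (a : Matrix n n ℂ)) * exp (mlog ((a : Matrix n n ℂ) * (V : Matrix n n ℂ) * star (c : Matrix n n ℂ) * star (V : Matrix n n ℂ))))
              - (a : Matrix n n ℂ) * mlog F * star (a : Matrix n n ℂ) - mlog ((a : Matrix n n ℂ) * (V : Matrix n n ℂ) * star (c : Matrix n n ℂ) * star (V : Matrix n n ℂ)))
          + ((((a : Matrix n n ℂ) - 1) * mlog F * star (a : Matrix n n ℂ) + mlog F * (star (a : Matrix n n ℂ) - 1)))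
          + (mlog (exp (mlog (a : Matrix n n ℂ)) * exp (-((V : Matrix n n ℂ) * mlog (c : Matrix n n ℂ) * star (V : Matrix n n ℂ))))
              - mlog (a : Matrix n n ℂ) - -((V : Matrix n n ℂ) * mlog (c : Matrix n n ℂ) * star (V : Matrix n n ℂ))) := by
    intro a c V F ha hc hF
    have ha1 : ‖(a : Matrix n n ℂ) - 1‖ < 1 := by linarith
    have hc1 : ‖(c : Matrix n n ℂ) - 1‖ < 1 := by linarith
    have hG : (a : Matrix n n ℂ) * (V : Matrix n n ℂ) * star (c : Matrix n n ℂ) * star (V : Matrix n n ℂ)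
        = exp (mlog (a : Matrix n n ℂ)) * exp (-((V : Matrix n n ℂ) * mlog (c : Matrix n n ℂ) * star (V : Matrix n n ℂ))) := by
      have e1 : -((V : Matrix n n ℂ) * mlog (c : Matrix n n ℂ) * star (V : Matrix n n ℂ)) = (V : Matrix n n ℂ) * (-mlog (c : Matrix n n ℂ)) * star (V : Matrix n n ℂ) := by
        rw [mul_neg, neg_mul]
      rw [e1, exp_conj_coe V, ← star_coe_eq_exp_neg_mlog c hc1, exp_mlog ha1]
      simp only [mul_assoc]
    have huu : star (a : Matrix n n ℂ) * (a : Matrix n n ℂ) = 1 := coe_star_mul_self a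
    rw [← regauge_eq_exp_mul_exp a c V F ha hc hF, ← hG]
    have e2 : ((a : Matrix n n ℂ) - 1) * mlog F * star (a : Matrix n n ℂ) + mlog F * (star (a : Matrix n n ℂ) - 1)
        = (a : Matrix n n ℂ) * mlog F * star (a : Matrix n n ℂ) - mlog F := by noncomm_ring
    rw [e2]
    abel
  -- apply the decomposition to both and subtract
  rw [hdec um up W E (h64 hm) (h64 hp) hE1, hdec um' up' W' E' (h64 hm') (h64 hp') hE1']
  -- term 1: C¹-BCH on `r(A, log G)`
  have hA : ‖(um : Matrix n n ℂ) * mlog E * star (um : Matrix n n ℂ)‖ ≤ 2 * τ := (norm_conj_su_le um _).trans hlogE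
  have hA' : ‖(um' : Matrix n n ℂ) * mlog E' * star (um' : Matrix n n ℂ)‖ ≤ 2 * τ := (norm_conj_su_le um' _).trans hlogE'
  have t1 := norm_bch_sub_bch_le_of_norm_le (X := (um : Matrix n n ℂ) * mlog E * star (um : Matrix n n ℂ))
    (Y := mlog ((um : Matrix n n ℂ) * (W : Matrix n n ℂ) * star (up : Matrix n n ℂ) * star (W : Matrix n n ℂ)))
    (X' := (um' : Matrix n n ℂ) * mlog E' * star (um' : Matrix n n ℂ))
    (Y' := mlog ((um' : Matrix n n ℂ) * (W' : Matrix n n ℂ) * star (up' : Matrix n n ℂ) * star (W' : Matrix n n ℂ)))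
    hA hA' hlogG hlogG' (by linarith) (by linarith)
  have dA : ‖(um : Matrix n n ℂ) * mlog E * star (um : Matrix n n ℂ) - (um' : Matrix n n ℂ) * mlog E' * star (um' : Matrix n n ℂ)‖
      ≤ 2 * (2 * τ) * ‖(um : Matrix n n ℂ) - (um' : Matrix n n ℂ)‖ + 3 * (2 * ‖E - E'‖) := by
    have h := norm_conj_sub_conj_le um um' (mlog E) (mlog E')
    have hl : ‖mlog E - mlog E'‖ ≤ 2 * ‖E - E'‖ := hlip (hE.trans (by linarith)) (hE'.trans (by linarith))
    have h0 : 0 ≤ ‖(um : Matrix n n ℂ) - (um' : Matrix n n ℂ)‖ := norm_nonneg _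
    have h1 : 2 * ‖mlog E‖ * ‖(um : Matrix n n ℂ) - (um' : Matrix n n ℂ)‖ ≤ 2 * (2 * τ) * ‖(um : Matrix n n ℂ) - (um' : Matrix n n ℂ)‖ :=
      mul_le_mul_of_nonneg_right (by linarith) h0
    linarith
  have dG : ‖mlog ((um : Matrix n n ℂ) * (W : Matrix n n ℂ) * star (up : Matrix n n ℂ) * star (W : Matrix n n ℂ))
        - mlog ((um' : Matrix n n ℂ) * (W' : Matrix n n ℂ) * star (up' : Matrix n n ℂ) * star (W' : Matrix n n ℂ))‖
      ≤ 2 * (‖(um : Matrix n n ℂ) - (um' : Matrix n n ℂ)‖ + ‖(up : Matrix n n ℂ) - (up' : Matrix n n ℂ)‖ + 2 * ‖(W : Matrix n n ℂ) - (W' : Matrix n n ℂ)‖) := by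
    have hl := hlip (hG1.trans (by linarith)) (hG1'.trans (by linarith))
    exact hl.trans (by gcongr; exact norm_twist_sub_twist_le um up W um' up' W')
  -- term 2: Leibniz
  have t2 := norm_bilin_sub_bilin_le um um' (mlog E) (mlog E')
  have hl2 : ‖mlog E - mlog E'‖ ≤ 2 * ‖E - E'‖ := hlip (hE.trans (by linarith)) (hE'.trans (by linarith))
  -- term 3: C¹-BCH on `r(log u₋, −W(log u₊)W*)`
  have hY : ‖-((W : Matrix n n ℂ) * mlog (up : Matrix n n ℂ) * star (W : Matrix n n ℂ))‖ ≤ 2 * σ := by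
    rw [norm_neg]; exact (norm_conj_su_le W _).trans (hlogu hp)
  have hY' : ‖-((W' : Matrix n n ℂ) * mlog (up' : Matrix n n ℂ) * star (W' : Matrix n n ℂ))‖ ≤ 2 * σ := by
    rw [norm_neg]; exact (norm_conj_su_le W' _).trans (hlogu hp')
  have t3 := norm_bch_sub_bch_le_of_norm_le (X := mlog (um : Matrix n n ℂ)) (Y := -((W : Matrix n n ℂ) * mlog (up : Matrix n n ℂ) * star (W : Matrix n n ℂ)))
    (X' := mlog (um' : Matrix n n ℂ)) (Y' := -((W' : Matrix n n ℂ) * mlog (up' : Matrix n n ℂ) * star (W' : Matrix n n ℂ)))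
    (hlogu hm) (hlogu hm') hY hY' (by linarith) (by linarith)
  have dμm : ‖mlog (um : Matrix n n ℂ) - mlog (um' : Matrix n n ℂ)‖ ≤ 2 * ‖(um : Matrix n n ℂ) - (um' : Matrix n n ℂ)‖ :=
    hlip (hm.trans (by linarith)) (hm'.trans (by linarith))
  have dY : ‖-((W : Matrix n n ℂ) * mlog (up : Matrix n n ℂ) * star (W : Matrix n n ℂ)) - -((W' : Matrix n n ℂ) * mlog (up' : Matrix n n ℂ) * star (W' : Matrix n n ℂ))‖
      ≤ 2 * (2 * σ) * ‖(W : Matrix n n ℂ) - (W' : Matrix n n ℂ)‖ + 3 * (2 * ‖(up : Matrix n n ℂ) - (up' : Matrix n n ℂ)‖) := by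
    have e : ‖-((W : Matrix n n ℂ) * mlog (up : Matrix n n ℂ) * star (W : Matrix n n ℂ)) - -((W' : Matrix n n ℂ) * mlog (up' : Matrix n n ℂ) * star (W' : Matrix n n ℂ))‖
        = ‖(W : Matrix n n ℂ) * mlog (up : Matrix n n ℂ) * star (W : Matrix n n ℂ) - (W' : Matrix n n ℂ) * mlog (up' : Matrix n n ℂ) * star (W' : Matrix n n ℂ)‖ := by
      rw [← norm_neg]; congr 1; abel
    rw [e]
    have h := norm_conj_sub_conj_le W W' (mlog (up : Matrix n n ℂ)) (mlog (up' : Matrix n n ℂ))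
    have hl : ‖mlog (up : Matrix n n ℂ) - mlog (up' : Matrix n n ℂ)‖ ≤ 2 * ‖(up : Matrix n n ℂ) - (up' : Matrix n n ℂ)‖ := hlip (hp.trans (by linarith)) (hp'.trans (by linarith))
    have h0 : 0 ≤ ‖(W : Matrix n n ℂ) - (W' : Matrix n n ℂ)‖ := norm_nonneg _
    have hμp : ‖mlog (up : Matrix n n ℂ)‖ ≤ 2 * σ := hlogu hp
    have h1 : 2 * ‖mlog (up : Matrix n n ℂ)‖ * ‖(W : Matrix n n ℂ) - (W' : Matrix n n ℂ)‖ ≤ 2 * (2 * σ) * ‖(W : Matrix n n ℂ) - (W' : Matrix n n ℂ)‖ :=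
      mul_le_mul_of_nonneg_right (by linarith) h0
    linarith
  -- assemble: `‖(a+b+c) − (a'+b'+c')‖ ≤ ‖a−a'‖ + ‖b−b'‖ + ‖c−c'‖`
  have hd0 : 0 ≤ ‖(um : Matrix n n ℂ) - (um' : Matrix n n ℂ)‖ := norm_nonneg _
  have hd1 : 0 ≤ ‖(up : Matrix n n ℂ) - (up' : Matrix n n ℂ)‖ := norm_nonneg _
  have hd2 : 0 ≤ ‖E - E'‖ := norm_nonneg _
  have hd3 : 0 ≤ ‖(W : Matrix n n ℂ) - (W' : Matrix n n ℂ)‖ := norm_nonneg _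
  have T1 := t1.trans (add_le_add (mul_le_mul_of_nonneg_left dA (by linarith)) (mul_le_mul_of_nonneg_left dG (by linarith)))
  have T2' : 3 * (‖mlog E‖ + ‖mlog E'‖) * ‖(um : Matrix n n ℂ) - (um' : Matrix n n ℂ)‖ + 2 * ‖(um' : Matrix n n ℂ) - 1‖ * ‖mlog E - mlog E'‖
      ≤ 3 * (2 * τ + 2 * τ) * ‖(um : Matrix n n ℂ) - (um' : Matrix n n ℂ)‖ + 2 * σ * (2 * ‖E - E'‖) := by
    have a1 : 3 * (‖mlog E‖ + ‖mlog E'‖) * ‖(um : Matrix n n ℂ) - (um' : Matrix n n ℂ)‖ ≤ 3 * (2 * τ + 2 * τ) * ‖(um : Matrix n n ℂ) - (um' : Matrix n n ℂ)‖ :=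
      mul_le_mul_of_nonneg_right (by linarith) hd0
    have a2 : 2 * ‖(um' : Matrix n n ℂ) - 1‖ * ‖mlog E - mlog E'‖ ≤ 2 * σ * (2 * ‖E - E'‖) :=
      mul_le_mul (by linarith) hl2 (norm_nonneg _) (by linarith)
    linarith
  have T2 := t2.trans T2'
  have T3 := t3.trans (add_le_add (mul_le_mul_of_nonneg_left dμm (by linarith)) (mul_le_mul_of_nonneg_left dY (by linarith)))
  rw [show ∀ (x y z x' y' z' : Matrix n n ℂ), (x + y + z) - (x' + y' + z') = (x - x') + (y - y') + (z - z') from fun _ _ _ _ _ _ => by abel]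
  refine norm_add₃_le.trans ((add_le_add (add_le_add T1 T2) T3).trans ?_)
  have hσ1 : σ ≤ 1 := by linarith
  have h1 : σ * τ * ‖(um : Matrix n n ℂ) - (um' : Matrix n n ℂ)‖ ≤ 1 * τ * ‖(um : Matrix n n ℂ) - (um' : Matrix n n ℂ)‖ :=
    mul_le_mul_of_nonneg_right (mul_le_mul_of_nonneg_right hσ1 hτ0) hd0
  have h2 : σ * σ * ‖(W : Matrix n n ℂ) - (W' : Matrix n n ℂ)‖ ≤ 1 * σ * ‖(W : Matrix n n ℂ) - (W' : Matrix n n ℂ)‖ :=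
    mul_le_mul_of_nonneg_right (mul_le_mul_of_nonneg_right hσ1 hσ0) hd3
  have p0 := mul_nonneg hσ0 hd0
  have p1 := mul_nonneg hσ0 hd1
  have p2 := mul_nonneg hσ0 hd2
  have p3 := mul_nonneg hσ0 hd3
  have q0 := mul_nonneg hτ0 hd0
  have q1 := mul_nonneg hτ0 hd1
  have q2 := mul_nonneg hτ0 hd2
  have q3 := mul_nonneg hτ0 hd3
  have r0 := mul_nonneg (mul_nonneg hσ0 hτ0) hd0
  have r3 := mul_nonneg (mul_nonneg hσ0 hσ0) hd3
  linarith

end Main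

end Summit.QuantumFields.YangMills.Theorems.Prop7PinnedRegaugeChartLipschitz

end
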